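import Summits.HodgeConjecture.CorCM.GaloisCyclicSemidirectTwoPowerResidue
import Summits.HodgeConjecture.CorCM.GaloisOddMetacyclicAllTypes
import Summits.HodgeConjecture.HodgeConjecture.Theorems.Ring2ClassTargets
import HarnessLib

/-!
# Galois CM fields with group `C_p ⋊ C_{2^{a+2}}`, `2^{a+2} ∤ p − 1`, `2^{a+1} ∤ p + 1`: EVERY abelian variety with complex
# multiplication by the field is STABLY NONDEGENERATE

COR-CM (cell `pub-hodgecm2`), binder seat b04 (gen 26), count-neutral claim CYCLIC-SEMIDIRECT-RESIDUE, part V♯b — the ALL-TYPES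
upgrade (gen 21 ENGINE, through `CorCM/GaloisOddMetacyclicAllTypes`) of `CorCM/GaloisCyclicSemidirectTwoPowerResidue` (every
PRIMITIVE CM type nondegenerate).  KERNEL ONLY: theorems; no definition,
no named fact, no `sorry`.  `HC_CM` is neither used nor claimed: the Hodge conjecture for a NAMED CLASS of abelian varieties,
UNCONDITIONALLY and WITHOUT simplicity.

SETTING.  `G₀ = C_p ⋊ C_{2^{a+2}} = Multiplicative (ZMod p) ⋊[φ] Multiplicative (ZMod (2^(a+2)))` (`φ(1)` = inversion,
`p` an odd prime), complex conjugation `c₀ = y^{2^{a+1}}` = the UNIQUE involution.  By `CorCM/GaloisOddMetacyclicAllTypes` (an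
admissible stabiliser has odd order, lies in `C_p`, and `G₀ ⧸ C_p ≅ C_{2^{a+2}}` is cyclic, so an imprimitive type is induced from the
cyclic CM field `K^{C_p}` of degree `2^{a+2}`, all of whose CM types are nondegenerate — gen 11) the engine yields: **every complex
abelian variety `X` of dimension `2^{a+1}p` with `K ↪ End⁰(X)` is stably nondegenerate** — `B = D` on all powers, HC for
everything isogenous to a power — as soon as every primitive CM type of `K` is nondegenerate, i.e. (part IV♯) whenever
`2^{a+1} ∣ p^f − 1`, `2^{a+2} ∤ p^f − 1` for some `f`, i.e. whenever `2^{a+2} ∤ p − 1` and `2^{a+1} ∤ p + 1`.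

* §1 **`isStablyNondegenerate_of_ringHom_cyclicSemidirect`** (hypothesis: primitive types nondegenerate),
  **`isStablyNondegenerate_of_ringHom_of_pow_sub_one`**, **`…_of_not_dvd`**, HC corollaries
  (`hodgeConjectureFor_of_isIsogenous_powSucc_of_not_dvd`, `hodgeConjectureFor_pow_of_not_dvd` — §1 of part IV♯ minus
  `A.IsSimple`), realisation form; §2 `HCOnClass` display.

## References

* [Shimura1998] G. Shimura, *Abelian Varieties with Complex Multiplication and Modular Functions* (1998), §5.1 Prop. 3,
  §8.2 Prop. 26.
* [Gordon1999HodgeAVSurvey] B. B. Gordon, *A survey of the Hodge conjecture for abelian varieties*, Thm. 6.4, Def. 7.6.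
* [Kubota1965] T. Kubota, Trans. AMS 118 (1965), §4 Lemma 2.
* [Dodson1984] B. Dodson, *The structure of Galois groups of CM-fields*, Trans. AMS 283 (1984), Prop. 5.2.2.
-/

noncomputable section

open CategoryTheory CategoryTheory.Limits NumberField

namespace Summit.HodgeConjecture.CorCM.GaloisCyclicSemidirectTwoPower

open Literature.NumberTheory.ComplexMultiplication
open Literature.AlgebraicGeometry Literature.AlgebraicGeometry.Motives Literature.AlgebraicGeometry.HodgeTheory
open Literature.AlgebraicGeometry.Motives.AbelianVariety
open Literature.AlgebraicGeometry.ComplexMultiplication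
open Literature.AlgebraicGeometry.Pohlmann1968
open Summit.HodgeConjecture.CorCM.GaloisRank
open Summit.HodgeConjecture.HodgeConjecture.Ring2.ClassTargets

/-! ## §1 Every abelian variety with a `K`-action is stably nondegenerate -/

section Field

variable {p a : ℕ} [Fact p.Prime]
variable {K : Type} [Field K] [NumberField K] [IsCMField K] [IsGalois ℚ K]

/-- **THEOREM (ALL TYPES, conditional form).  `K` Galois CM with `Gal(K/ℚ) ≅ C_p ⋊ C_{2^{a+2}}` (`p` odd, `φ(1)` =
inversion) such that every PRIMITIVE CM type of `K` is nondegenerate.  Then EVERY complex abelian variety `X` with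
`ψ : K →+* End⁰(X)` and `[K:ℚ] = 2 dim X` is STABLY NONDEGENERATE** — the case `r = p − 1`, `k = a + 1` of
`GaloisOddMetacyclic.isStablyNondegenerate_of_ringHom_metacyclic`. [cite: Shimura1998, §5.1 Prop. 3, §8.2 Prop. 26]
[cite: Gordon1999HodgeAVSurvey, Thm. 6.4 and Def. 7.6] [cite: Kubota1965, §4 Lemma 2] -/
theorem isStablyNondegenerate_of_ringHom_cyclicSemidirect (hp2 : p ≠ 2)
    (φ : Multiplicative (ZMod (2 ^ (a + 2))) →* MulAut (Multiplicative (ZMod p)))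
    (hφ : ∀ v : Multiplicative (ZMod p), φ (Multiplicative.ofAdd 1) v = v⁻¹)
    (e : (K ≃ₐ[ℚ] K) ≃* Multiplicative (ZMod p) ⋊[φ] Multiplicative (ZMod (2 ^ (a + 2))))
    (hprim : ∀ (Φ : CMType K) (φ₀ : K →+* ℂ), IsPrimitive (ℂ ≃+* ℂ) Φ.1 φ₀ → IsNondegenerate Φ)
    {X : AbelianVariety ℂ} (ψ : K →+* X.endAlgebra) (hX : Module.finrank ℚ K = 2 * X.dim) :
    IsStablyNondegenerate X :=
  have hp : p.Prime := Fact.out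
  GaloisOddMetacyclic.isStablyNondegenerate_of_ringHom_metacyclic (k := a + 1) (p - 1) hp2
    (GaloisOddMetacyclic.pred_pow_two_pow_mod hp) φ (GaloisOddMetacyclic.phi_one_eq_pow_of_inv hp φ hφ) e hprim ψ hX

/-- **THEOREM (ALL TYPES).  `K` Galois CM with `Gal(K/ℚ) ≅ C_p ⋊ C_{2^{a+2}}` (`p` odd, `φ(1)` = inversion),
`2^{a+1} ∣ p^f − 1` and `2^{a+2} ∤ p^f − 1` for some `f`: EVERY complex abelian variety `X` with `K ↪ End⁰(X)` and
`[K:ℚ] = 2 dim X` (dimension `2^{a+1}p`) is STABLY NONDEGENERATE** — unconditionally.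
[cite: Shimura1998, §5.1 Prop. 3, §8.2 Prop. 26] [cite: Gordon1999HodgeAVSurvey, Thm. 6.4 and Def. 7.6] -/
theorem isStablyNondegenerate_of_ringHom_of_pow_sub_one (hp2 : p ≠ 2) {f : ℕ} (hf1 : 2 ^ (a + 1) ∣ p ^ f - 1)
    (hf2 : ¬ 2 ^ (a + 2) ∣ p ^ f - 1)
    (φ : Multiplicative (ZMod (2 ^ (a + 2))) →* MulAut (Multiplicative (ZMod p)))
    (hφ : ∀ v : Multiplicative (ZMod p), φ (Multiplicative.ofAdd 1) v = v⁻¹)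
    (e : (K ≃ₐ[ℚ] K) ≃* Multiplicative (ZMod p) ⋊[φ] Multiplicative (ZMod (2 ^ (a + 2))))
    {X : AbelianVariety ℂ} (ψ : K →+* X.endAlgebra) (hX : Module.finrank ℚ K = 2 * X.dim) :
    IsStablyNondegenerate X :=
  isStablyNondegenerate_of_ringHom_cyclicSemidirect hp2 φ hφ e
    (fun _ φ₀ hprim => isNondegenerate_of_isPrimitive_of_pow_sub_one hp2 hf1 hf2 φ hφ e φ₀ hprim) ψ hX

/-- **THEOREM (ALL TYPES, closed form): `2^{a+2} ∤ p − 1` and `2^{a+1} ∤ p + 1` ⟹ every `X` with `K ↪ End⁰(X)`,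
`[K:ℚ] = 2 dim X`, is stably nondegenerate.** [cite: Shimura1998, §5.1 Prop. 3, §8.2 Prop. 26]
[cite: Gordon1999HodgeAVSurvey, Thm. 6.4 and Def. 7.6] -/
theorem isStablyNondegenerate_of_ringHom_of_not_dvd (hp2 : p ≠ 2) (h1 : ¬ 2 ^ (a + 2) ∣ p - 1)
    (h2 : ¬ 2 ^ (a + 1) ∣ p + 1)
    (φ : Multiplicative (ZMod (2 ^ (a + 2))) →* MulAut (Multiplicative (ZMod p)))
    (hφ : ∀ v : Multiplicative (ZMod p), φ (Multiplicative.ofAdd 1) v = v⁻¹)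
    (e : (K ≃ₐ[ℚ] K) ≃* Multiplicative (ZMod p) ⋊[φ] Multiplicative (ZMod (2 ^ (a + 2))))
    {X : AbelianVariety ℂ} (ψ : K →+* X.endAlgebra) (hX : Module.finrank ℚ K = 2 * X.dim) :
    IsStablyNondegenerate X :=
  isStablyNondegenerate_of_ringHom_cyclicSemidirect hp2 φ hφ e
    (fun _ φ₀ hprim => isNondegenerate_of_isPrimitive_of_not_dvd hp2 h1 h2 φ hφ e φ₀ hprim) ψ hX

/-- **The Hodge conjecture for everything isogenous to a power of such an `X`** — no simplicity. UNCONDITIONAL.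
[cite: Gordon1999HodgeAVSurvey, Thm. 6.3–6.4] -/
theorem hodgeConjectureFor_of_isIsogenous_powSucc_of_not_dvd (hp2 : p ≠ 2) (h1 : ¬ 2 ^ (a + 2) ∣ p - 1)
    (h2 : ¬ 2 ^ (a + 1) ∣ p + 1)
    (φ : Multiplicative (ZMod (2 ^ (a + 2))) →* MulAut (Multiplicative (ZMod p)))
    (hφ : ∀ v : Multiplicative (ZMod p), φ (Multiplicative.ofAdd 1) v = v⁻¹)
    (e : (K ≃ₐ[ℚ] K) ≃* Multiplicative (ZMod p) ⋊[φ] Multiplicative (ZMod (2 ^ (a + 2))))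
    {X : AbelianVariety ℂ} (ψ : K →+* X.endAlgebra) (hX : Module.finrank ℚ K = 2 * X.dim)
    {B : AbelianVariety ℂ} {N : ℕ} (h : IsIsogenous B (X.powSucc N)) : HodgeConjectureFor B.dim B.X :=
  (isStablyNondegenerate_of_ringHom_of_not_dvd hp2 h1 h2 φ hφ e ψ hX).hodgeConjectureFor_of_isIsogenous_powSucc h

/-- The Hodge conjecture for every power `X^{N+1}`. [cite: Gordon1999HodgeAVSurvey, Thm. 6.4 and Def. 7.6] -/
theorem hodgeConjectureFor_powSucc_of_ringHom_of_not_dvd (hp2 : p ≠ 2) (h1 : ¬ 2 ^ (a + 2) ∣ p - 1)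
    (h2 : ¬ 2 ^ (a + 1) ∣ p + 1)
    (φ : Multiplicative (ZMod (2 ^ (a + 2))) →* MulAut (Multiplicative (ZMod p)))
    (hφ : ∀ v : Multiplicative (ZMod p), φ (Multiplicative.ofAdd 1) v = v⁻¹)
    (e : (K ≃ₐ[ℚ] K) ≃* Multiplicative (ZMod p) ⋊[φ] Multiplicative (ZMod (2 ^ (a + 2))))
    {X : AbelianVariety ℂ} (ψ : K →+* X.endAlgebra) (hX : Module.finrank ℚ K = 2 * X.dim) (N : ℕ) :
    HodgeConjectureFor (X.powSucc N).dim (X.powSucc N).X :=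
  (isStablyNondegenerate_of_ringHom_of_not_dvd hp2 h1 h2 φ hφ e ψ hX).hodgeConjectureFor_powSucc N

variable {Φ : CMType K} {A : AbelianVariety ℂ} {ι : 𝓞 K →+* End A} {θ : K →+* Module.End ℂ (complexBetti A.X 1)}

/-- **Realisation form**: every abelian variety `(A, ι)` of ANY CM type `(K; Φ)` is stably nondegenerate, for
`2^{a+2} ∤ p − 1`, `2^{a+1} ∤ p + 1`. [cite: Shimura1998, §5.1–5.2] [cite: Gordon1999HodgeAVSurvey, Thm. 6.4] -/
theorem isStablyNondegenerate_of_isCMTypeRealisation_of_not_dvd (hp2 : p ≠ 2) (h1 : ¬ 2 ^ (a + 2) ∣ p - 1)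
    (h2 : ¬ 2 ^ (a + 1) ∣ p + 1)
    (φ : Multiplicative (ZMod (2 ^ (a + 2))) →* MulAut (Multiplicative (ZMod p)))
    (hφ : ∀ v : Multiplicative (ZMod p), φ (Multiplicative.ofAdd 1) v = v⁻¹)
    (e : (K ≃ₐ[ℚ] K) ≃* Multiplicative (ZMod p) ⋊[φ] Multiplicative (ZMod (2 ^ (a + 2))))
    (hA : IsCMTypeRealisation Φ A ι θ) : IsStablyNondegenerate A := by
  obtain ⟨i, -⟩ := exists_ringHom_endAlgebra ι
  exact isStablyNondegenerate_of_ringHom_of_not_dvd hp2 h1 h2 φ hφ e i (finrank_eq_two_mul_dim_of_isCMTypeRealisation hA)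

/-- **THE HODGE CONJECTURE FOR EVERY POWER OF EVERY ABELIAN VARIETY WITH CM BY A GALOIS CM FIELD WITH GROUP
`C_p ⋊ C_{2^{a+2}}`, `2^{a+2} ∤ p − 1`, `2^{a+1} ∤ p + 1`** — part IV♯'s `hodgeConjectureFor_pow_of_isSimple_of_not_dvd`
WITHOUT `A.IsSimple`. UNCONDITIONAL. [cite: Gordon1999HodgeAVSurvey, Thm. 6.4] [cite: Shimura1998, §5.1 Prop. 3 and §8.2 Prop. 26] -/
theorem hodgeConjectureFor_pow_of_not_dvd (hp2 : p ≠ 2) (h1 : ¬ 2 ^ (a + 2) ∣ p - 1) (h2 : ¬ 2 ^ (a + 1) ∣ p + 1)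
    (φ : Multiplicative (ZMod (2 ^ (a + 2))) →* MulAut (Multiplicative (ZMod p)))
    (hφ : ∀ v : Multiplicative (ZMod p), φ (Multiplicative.ofAdd 1) v = v⁻¹)
    (e : (K ≃ₐ[ℚ] K) ≃* Multiplicative (ZMod p) ⋊[φ] Multiplicative (ZMod (2 ^ (a + 2))))
    (hA : IsCMTypeRealisation Φ A ι θ) (N : ℕ) :
    HodgeConjectureFor (⨁ fun _ : Fin N => A).dim (⨁ fun _ : Fin N => A).X :=
  hodgeConjectureFor_of_isDivisorGenerated _
    ((isStablyNondegenerate_iff_forall_isDivisorGenerated_biproduct A).1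
      (isStablyNondegenerate_of_isCMTypeRealisation_of_not_dvd hp2 h1 h2 φ hφ e hA) N)

/-- Realisation form with the residue-field hypotheses `2^{a+1} ∣ p^f − 1`, `2^{a+2} ∤ p^f − 1`.
[cite: Shimura1998, §5.1–5.2] [cite: Gordon1999HodgeAVSurvey, Thm. 6.4] -/
theorem hodgeConjectureFor_pow_of_pow_sub_one (hp2 : p ≠ 2) {f : ℕ} (hf1 : 2 ^ (a + 1) ∣ p ^ f - 1)
    (hf2 : ¬ 2 ^ (a + 2) ∣ p ^ f - 1)
    (φ : Multiplicative (ZMod (2 ^ (a + 2))) →* MulAut (Multiplicative (ZMod p)))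
    (hφ : ∀ v : Multiplicative (ZMod p), φ (Multiplicative.ofAdd 1) v = v⁻¹)
    (e : (K ≃ₐ[ℚ] K) ≃* Multiplicative (ZMod p) ⋊[φ] Multiplicative (ZMod (2 ^ (a + 2))))
    (hA : IsCMTypeRealisation Φ A ι θ) (N : ℕ) :
    HodgeConjectureFor (⨁ fun _ : Fin N => A).dim (⨁ fun _ : Fin N => A).X := by
  obtain ⟨i, -⟩ := exists_ringHom_endAlgebra ι
  exact hodgeConjectureFor_of_isDivisorGenerated _
    ((isStablyNondegenerate_iff_forall_isDivisorGenerated_biproduct A).1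
      (isStablyNondegenerate_of_ringHom_of_pow_sub_one hp2 hf1 hf2 φ hφ e i
        (finrank_eq_two_mul_dim_of_isCMTypeRealisation hA)) N)

end Field

/-! ## §2 Class-target display -/

/-- **HC on the class «isogenous to a power of an abelian variety `X` with an action of a Galois CM field `K`,
`Gal(K/ℚ) ≅ C_p ⋊ C_{2^{a+2}}` (inversion action), `2^{a+2} ∤ p − 1`, `2^{a+1} ∤ p + 1`, `[K:ℚ] = 2 dim X`»** —
UNCONDITIONAL, NO simplicity. [cite: Gordon1999HodgeAVSurvey, Thm. 6.3–6.4] -/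
theorem hcOnClass_isIsogenous_powSucc_galoisCM_cyclicSemidirect :
    HCOnClass fun B ↦ ∃ (X : AbelianVariety ℂ) (N : ℕ) (K : Type) (_ : Field K) (_ : NumberField K)
      (_ : IsCMField K) (_ : IsGalois ℚ K) (p a : ℕ) (_ : Fact p.Prime)
      (φ : Multiplicative (ZMod (2 ^ (a + 2))) →* MulAut (Multiplicative (ZMod p)))
      (_ : (K ≃ₐ[ℚ] K) ≃* Multiplicative (ZMod p) ⋊[φ] Multiplicative (ZMod (2 ^ (a + 2)))),
      p ≠ 2 ∧ (∀ v : Multiplicative (ZMod p), φ (Multiplicative.ofAdd 1) v = v⁻¹) ∧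
      ¬ 2 ^ (a + 2) ∣ p - 1 ∧ ¬ 2 ^ (a + 1) ∣ p + 1 ∧ Module.finrank ℚ K = 2 * X.dim ∧
      Nonempty (K →+* X.endAlgebra) ∧ IsIsogenous B (X.powSucc N) := by
  rintro B ⟨X, N, K, _, _, _, _, p, a, _, φ, e, hp2, hφ, h1, h2, hX, ⟨ψ⟩, h⟩
  exact hodgeConjectureFor_of_isIsogenous_powSucc_of_not_dvd hp2 h1 h2 φ hφ e ψ hX h

end Summit.HodgeConjecture.CorCM.GaloisCyclicSemidirectTwoPower

end
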